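import Mathlib
import Summits.NavierStokesRegularity.NavierStokesRegularity.Theses.MirrorChamber
import HarnessLib

/-!
# `MirrorChamber.ChamberBlowupOfProfile` — glue of the crux-strategist split of `ChamberBlowup`
  (route `MirrorChamber`, item stmt-NavierStokesRegularity-17632, support)

**Statement.** `ChamberDssProfile → EquivariantTruncation → ChamberBlowup`.

PROOF. Feed the profile into the truncation bridge: it returns a classical Leray–Hopf solution
`(u, p)` (`ν = 1`) on `[0, T)` from a rapidly decaying datum, `B₃`-equivariant on `[0, T)`, bounded
by `M₀` off a ball `B_R`, and unbounded on `[0, T) × ℝ³`. It is a MAXIMAL smooth solution: a classical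
continuation `v` to `[0, T')`, `T' > T`, agrees with `u` on `[0, T)` and is continuous on the compact
`[0, T] × B̄_R`, hence bounded there — with the far-field bound this bounds `u` on `[0,T) × ℝ³`,
contradicting unboundedness.

HONEST FRAMING: glue between statements about HYPOTHETICAL equivariant profiles/blow-ups; nothing
here bears on the regularity problem itself.
-/

noncomputable section

set_option linter.dupNamespace false

namespace Summit.NavierStokesRegularity.NavierStokesRegularity.Theorems

open MeasureTheory Set Function Metric
open Literature.Analysis Literature.Analysis.FluidPDE

/-- **Unbounded classical solutions with a far-field bound are maximal**: if `(u, p)` is classical on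
`[0, T)`, bounded off a ball uniformly in `t ∈ [0, T)`, and unbounded on `[0, T) × ℝ³`, then it has no
smooth extension past `T`. [folklore] -/
theorem not_hasSmoothExtensionPast_of_unbounded {ν T : ℝ}
    {u : ℝ → EuclideanSpace ℝ (Fin 3) → EuclideanSpace ℝ (Fin 3)}
    (hfar : ∃ R M : ℝ, ∀ t ∈ Ico 0 T, ∀ x : EuclideanSpace ℝ (Fin 3), R ≤ ‖x‖ → ‖u t x‖ ≤ M)
    (hunb : ∀ M : ℝ, ∃ t ∈ Ico 0 T, ∃ x : EuclideanSpace ℝ (Fin 3), M < ‖u t x‖) :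
    ¬ HasSmoothExtensionPast ν 0 u T := by
  rintro ⟨T', hT', v, q, hcl, hagree⟩
  obtain ⟨R, M₀, hfarb⟩ := hfar
  -- `v` is continuous on the compact `[0, T] × closedBall 0 R`
  have hcont : ContinuousOn (uncurry v) (Icc 0 T ×ˢ closedBall (0 : EuclideanSpace ℝ (Fin 3)) R) :=
    hcl.smooth_velocity.continuousOn.mono (prod_mono (Icc_subset_Ico_right hT') (subset_univ _))
  have hK : IsCompact (Icc 0 T ×ˢ closedBall (0 : EuclideanSpace ℝ (Fin 3)) R) :=
    isCompact_Icc.prod (isCompact_closedBall _ _)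
  obtain ⟨M₁, hM₁⟩ := hK.exists_bound_of_continuousOn hcont
  -- contradiction with unboundedness
  obtain ⟨t, ht, x, hx⟩ := hunb (max M₀ M₁)
  have hut : u t = v t := (hagree t ht).symm
  rcases le_or_gt R ‖x‖ with hxR | hxR
  · exact absurd (hfarb t ht x hxR) (not_le.2 ((le_max_left _ _).trans_lt hx))
  · have hmem : (t, x) ∈ Icc 0 T ×ˢ closedBall (0 : EuclideanSpace ℝ (Fin 3)) R :=
      ⟨⟨ht.1, ht.2.le⟩, mem_closedBall_zero_iff.2 hxR.le⟩
    have h1 := hM₁ (t, x) hmem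
    simp only [uncurry_apply_pair] at h1
    rw [← congrFun hut x] at h1
    exact absurd h1 (not_le.2 ((le_max_right _ _).trans_lt hx))

/-- **Item stmt-NavierStokesRegularity-17632** (`MirrorChamber.ChamberBlowupOfProfile`): the glue
`ChamberDssProfile → EquivariantTruncation → ChamberBlowup`. [this file] -/
theorem mirrorChamber_chamberBlowupOfProfile_proof :
    Summit.NavierStokesRegularity.NavierStokesRegularity.Theses.MirrorChamber.ChamberBlowupOfProfile := by
  unfold Summit.NavierStokesRegularity.NavierStokesRegularity.Theses.MirrorChamber.ChamberBlowupOfProfile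
    Summit.NavierStokesRegularity.NavierStokesRegularity.Theses.MirrorChamber.ChamberDssProfile
    Summit.NavierStokesRegularity.NavierStokesRegularity.Theses.MirrorChamber.EquivariantTruncation
    Summit.NavierStokesRegularity.NavierStokesRegularity.Theses.MirrorChamber.ChamberBlowup
  rintro ⟨c, hc, U, hU, hmeas, hdss, hdecay, hequi, hne⟩ hTr
  obtain ⟨T, hT, u, p, hcl, hLH, hdec, hequ, hfar, hunb⟩ := hTr c U hc hU hmeas hdss hdecay hequi hne
  exact ⟨1, one_pos, T, hT, u, p, ⟨hcl, not_hasSmoothExtensionPast_of_unbounded hfar hunb⟩,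
    hLH, hdec, hequ⟩

end Summit.NavierStokesRegularity.NavierStokesRegularity.Theorems

end
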